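import Summits.ValiantsHypothesis.ValiantsHypothesis.Theorems.NewtonUnitEquationsTwoProductsMomentRecordLiftRecord
import Summits.ValiantsHypothesis.ValiantsHypothesis.Theorems.NewtonUnitEquationsTwoProductsMomentRecordCount

/-!
# R12 — THE SHIFTED-CARRIER CELL LAW (B) `ShiftedCarrierLaw`, PROVED (composition of the two landed chains)

`ShiftedCarrierLaw` (crit-8 g2, ✓ `…MomentRecordDefs`): absolute `a, b` such that every normalised `t`-sparse instance `(u, v)` of `m` factor
pairs whose tail alphabet lies in `X ⊔ (X + d)` (carriers `x : Fin n → ℕ²`, ONE shift `d ∈ ℤ²`), carrier-dissociated to depth `m`, obeys the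
per-cell law `#S ≤ 2^(a m) (t+2)^b` for every cell family `S` (`IsCellFamily`).  PROOF = one line:
(A∘) `MomentRecordLawUsed` is PROVED (`…MomentRecord.momentRecordLawUsed_holds`, ✓ `…MomentRecordCount`, idea-37 g4's «record letters are free»,
transplanted by val-port-3 g3) and (A∘) ⇒ (B) is PROVED (`…MomentRecord.Lift.shiftedCarrier_of_lawUsed_holds`, ✓ `…MomentRecordLiftRecord`, the
lumped free-ring transfer).  Also the a-fortiori variant (B♯) `ShiftedCarrierLawAll` and the two typed glue targets of `…MomentRecordRungDefs` that
it makes trivial.  Credit of record (desk #356/#357, crit-8 22:36:40Z): statements crit-8 g2 (W3/W4); record lemma val-idea-34 g5 · 37 g3/g4 · 35 g3;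
kernel count idea-37 g4; transplant val-port-3 g3; transfer val-lit-p3 g17; instruments val-neg-1 g6.
HONEST LABEL: a CLASS rung of the relation ladder (R11 → R12: the first log-concise class with a shifted alphabet); inert as a hatch; it says
nothing about `PlanarCellBound` off the class; `ResidualLawV23`, `PlanarCellBound`, the crux `TwoProducts` (stmt-ValiantsHypothesis-5906) stay OPEN;
VP ≠ VNP is NOT proved.  Helper mode (`--supports stmt-ValiantsHypothesis-5906 --as helper`). [folklore]
-/

set_option linter.dupNamespace false

noncomputable section

namespace Summit.ValiantsHypothesis.ValiantsHypothesis.Theorems.NewtonUnitEquations.TwoProducts.MomentRecord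
open Summit.ValiantsHypothesis.ValiantsHypothesis.Theorems.NewtonUnitEquations.TwoProducts.FormalLogLinearisation
open Summit.ValiantsHypothesis.ValiantsHypothesis.Theorems.NewtonUnitEquations.TwoProducts.PlanarCell

/-- **(B) THE SHIFTED-CARRIER CELL LAW, PROVED**: `ShiftedCarrierLaw` holds (constants those of `momentRecordLawUsed_holds`). [folklore] -/
theorem shiftedCarrierLaw_holds : ShiftedCarrierLaw :=
  Lift.shiftedCarrier_of_lawUsed_holds momentRecordLawUsed_holds

/-- All-depth dissociation implies depth-`m` dissociation. [folklore] -/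
theorem carrierDissociated_of_all {n : ℕ} {x : Fin n → Expo} {d : Fin 2 → ℤ} {m : ℕ} (h : CarrierDissociatedAll x d m) :
    CarrierDissociated x d m :=
  fun S S' k k' hS _ hk hk' hpt => h S S' k k' hS hk hk' hpt

/-- **(B♯) `ShiftedCarrierLawAll`, PROVED** (a fortiori from (B)). [folklore] -/
theorem shiftedCarrierLawAll_holds : ShiftedCarrierLawAll := by
  obtain ⟨a, b, h⟩ := shiftedCarrierLaw_holds
  exact ⟨a, b, fun m t n u v x d ht hu hv halph hdis R S hS => h m t n u v x d ht hu hv halph (carrierDissociated_of_all hdis) R S hS⟩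

/-- The typed glue `shiftedCarrierAll_of_lawUsed` of `…MomentRecordRungDefs`, discharged. [folklore] -/
theorem shiftedCarrierAll_of_lawUsed_holds : shiftedCarrierAll_of_lawUsed := fun _ => shiftedCarrierLawAll_holds

/-- The typed glue `shiftedCarrierAll_of_bound` of `…MomentRecordRungDefs`, discharged. [folklore] -/
theorem shiftedCarrierAll_of_bound_holds : shiftedCarrierAll_of_bound := fun _ => shiftedCarrierLawAll_holds

end Summit.ValiantsHypothesis.ValiantsHypothesis.Theorems.NewtonUnitEquations.TwoProducts.MomentRecord

end
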